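/-
Copyright (c) 2026 the pub-hodgecm-mathlib formalisation cell (harness21).  Prover seat hodgecm-mathlib-LH4-p18 (g0), req620 Track A «(D-RAM) FOUR-FRAME» squad, helper lane on
h413 = stmt-HodgeConjecture-24833 (count-neutral).  β-BOARD v1 row R5 «G₃ ε-BOUNDARY»: THE `hbeyond` HEAD — slot 0 = ★ p861925 THEOREM A (LH7-p06 (g0)), slot 1 = THEOREM A ∘ (0 1), slot 2 = 0.  2026-09-04.
-/
import Summits.HodgeConjecture.HodgeConjecture.Theorems.F0P3cDyRamLabelledOddBoundaryG3SlotZero    -- ★ p861925 (LH7-p06 (g0)) THEOREM A: `finsum_stratum_G3_shell_labelledOdd_div_relIndex_beyond_zero` (slot 0 beyond the n₁-cell)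
import Summits.HodgeConjecture.HodgeConjecture.Theorems.F0P3cDyRamLabelledOddBoundaryG3SlotTwo     -- ★ p861837 (this seat): `finsum_stratum_G3_shell_labelledOdd_div_relIndex_slot_two_eq_zero` (slot 2 ≡ 0 on the capped tube)
import Summits.HodgeConjecture.HodgeConjecture.Theorems.F0P3cDyRamLabelledOddBoundaryG3OfSwap      -- ★ p861504 (this seat) R5a: `…_beyond_of_cell₂` (the n₂-cell half); brings ★ p861439 engine, ★ `…ElementDatumParity`
import Literature.NumberTheory.LocalFields.WildQuadraticDatumNormSignConductor                        -- ★: `normSign_mul_of_fixed`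
import HarnessLib

/-!
# Crux `H413`, line LH4 «(D-RAM) FOUR-FRAME» — (β-BAL) Stage B, β-BOARD ROW R5 «G₃ ε-BOUNDARY»: THE `hbeyond` HEAD OF ★ p861354 ∕ THE BEYOND PART OF (T2)'s `hP2G3`
# `Σᶠ_{M ∈ stratum (2ρ+s,2ρ+s,2ρ), clean shell} m^Λ_i(M) ∕ [𝒰 : N(S̃(M))] = ω(e_C)∕2 · q^{2ρ+s∕2−1} · (ω(−1)·B(n₁), B(n₂), 0)_i` on `n₁ < 2ρ + m*` (read, `2 ∣ s`, tube guard)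

Cell `hodgecm-mathlib` (D-0151), FLOOR 0, crux item H413 = `stmt-HodgeConjecture-24833`, route `HCCMUnconditional`; squad F0∕P3c∕LH4.  THEOREMS ONLY (no `def`, no instance, no
notation, no `sorry`, default heartbeats); ★-only imports; lane `--supports stmt-HodgeConjecture-24833 --as helper` (count-neutral); pays NO row, states NO law.
`B(n) = (if 2d + ℓ₀ + 2ρ ≤ n then q − 1 else 0) − (if n + 2 = 2d + ℓ₀ + 2ρ then 1 else 0)` VERBATIM as in ★ (T1) p861261 `hG3t` ∕ (T2) `hP2G3` ∕ ★ p861354 `hbeyond`.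
* §1 **`finsum_stratum_G3_shell_labelledOdd_div_relIndex_beyond_one`** — SLOT 1 beyond the `n₂`-cell (`n₂ < 2ρ + m*`): ★ p861925 THEOREM A (LH7-p06 (g0)) (slot 0 beyond the `n₁`-cell) at the
  swapped datum `(β, α; n₂, n₁, n₃)` through ★ p861439 `finsum_stratum_shell_labelledOdd_div_relIndex_swap01` (the G₃ stratum, its shell and the value-class label are `(0 1)`-symmetric;
  token `−e_C` of `α − β`; `ω(−e_C)·ω(−1) = ω(e_C)`).
* §2 **`finsum_stratum_G3_shell_labelledOdd_div_relIndex_beyond₂`** — R5b, all three slots on `n₁, n₂ < 2ρ + m*`: slot 0 = THEOREM A, slot 1 = §1, slot 2 = ★ p861837.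
* §3 **`finsum_stratum_G3_shell_labelledOdd_div_relIndex_beyond`** — THE WHOLE `hbeyond` BINDER (`n₁ < 2ρ + m*`, no condition on `n₂`): `Nat.lt_or_ge n₂ (2ρ + m*)` ⇒ §2 or ★ p861504 R5a
  `…_beyond_of_cell₂`; so (T2)'s `hP2G3 := ★ p861354 hG3t_of_cell_and_beyond ‹cell ★ …_eq_ofRecord› ‹this›`.
HONEST LABEL.  Count-neutral; closes the G₃ boundary row of the (β) table modulo the assembler's composition; the table identity, (β-BAL), (β) `stub_law_cleanSgn`, T₊ remain OPEN;
`HC_CM` is proved only modulo the 7 printed citations (2 remaining named inputs: hLiu418 = `stmt-HodgeConjecture-24832`, h413 = `stmt-HodgeConjecture-24833`) until rung 0 closes.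

## References
* [Kottwitz1986BaseChangeUnits] R. E. Kottwitz, *Base change for unit elements of Hecke algebras*, Compositio Math. 60 (1986), §1 pp. 240–241.
* [Rogawski1990] J. D. Rogawski, *Automorphic Representations of Unitary Groups in Three Variables*, Ann. of Math. Stud. 123 (1990), §4.9 Prop. 4.9.1 (a)(b) p. 55, §4.10 p. 58.
* [LanglandsShelstad1987] R. P. Langlands, D. Shelstad, *On the definition of transfer factors*, Math. Ann. 278 (1987), §3.
* [Serre1979] J.-P. Serre, *Local Fields*, GTM 67 (1979), Ch. V §3 Cor. 3.
-/

set_option autoImplicit false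

noncomputable section

namespace Summit.HodgeConjecture.HodgeConjecture.Cruxes.H413.F0P3cDyRamLabelledOddBoundaryG3Beyond

open Matrix WithZero
open Literature.NumberTheory.Automorphic Literature.NumberTheory.Automorphic.HermitianLattice
open Literature.NumberTheory.Automorphic.UnitaryLatticeTree Literature.NumberTheory.Automorphic.UnitaryThreeFourFrame
open Literature.NumberTheory.LocalFields Literature.NumberTheory.LocalFields.WildQuadraticDatum
open Summit.HodgeConjecture.HodgeConjecture.Cruxes.H413.F0P3cDyRamFourFramePieces
open Summit.HodgeConjecture.HodgeConjecture.Cruxes.H413.F0P3cDyRamFourFrameCensusDefs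
open Summit.HodgeConjecture.HodgeConjecture.Cruxes.H413.F0P3cDyRamStageOneBDefs (mcOfRecord)
open Summit.HodgeConjecture.HodgeConjecture.Cruxes.H413.F0P3cDyRamDiagonalTorusDefs
open Summit.HodgeConjecture.HodgeConjecture.Cruxes.H413.F0P3cDyRamDiagonalStrataDefs
open Summit.HodgeConjecture.HodgeConjecture.Cruxes.H413.F0P3cDyRamDiagonalPermutation (exists_gl_coe_eq_permMatrix coe_conj_eq_diagonal isElementDatum_swap)
open Summit.HodgeConjecture.HodgeConjecture.Cruxes.H413.F0P3cDyRamLabelledOddCountDefs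
open Summit.HodgeConjecture.HodgeConjecture.Cruxes.H413.F0P3cDyRamLabelledOddSwapEngine (finsum_stratum_shell_labelledOdd_div_relIndex_swap01)
open Summit.HodgeConjecture.HodgeConjecture.Cruxes.H413.F0P3cDyRamLabelledOddBoundaryG3SlotZero (finsum_stratum_G3_shell_labelledOdd_div_relIndex_beyond_zero)
open Summit.HodgeConjecture.HodgeConjecture.Cruxes.H413.F0P3cDyRamLabelledOddBoundaryG3SlotTwo (finsum_stratum_G3_shell_labelledOdd_div_relIndex_slot_two_eq_zero)
open Summit.HodgeConjecture.HodgeConjecture.Cruxes.H413.F0P3cDyRamLabelledOddBoundaryG3OfSwap (finsum_stratum_G3_shell_labelledOdd_div_relIndex_beyond_of_cell₂)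
open scoped Valued WithZero Matrix MatrixGroups

variable {K : Type} [Field K] [Valued K ℤᵐ⁰] [CompleteSpace K] [Fintype 𝓀[K]] {σ : K →+* K} {ϖ : K} {d t : ℕ} {α β : K} {N₀ n₁ n₂ n₃ : ℕ}

/-! ## §1  Slot 1 beyond the `n₂`-cell: THEOREM A at the swapped datum, by the (0 1)-swap engine -/

/-- **SLOT `1` OF THE G₃ CAPPED TUBE BEYOND THE `n₂`-CELL** (`n₂ < 2ρ + m*`; read `2ρ + s + ℓ₀ = n₃`, `2 ∣ s`, guard `2ρ + 2 + ℓ₀ ≤ min n₁ n₂`; token `e_C` of `β − α`):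
`Σᶠ_{M ∈ stratum G₃, shell} m^Λ_1(M) ∕ [𝒰 : N(S̃(M))] = ω(e_C)∕2 · q^{2ρ+s∕2−1} · B(n₂)` — ★ p861925 THEOREM A (LH7-p06 (g0)) at `(β, α; n₂, n₁, n₃)` (token `−e_C` of `α − β`) carried back by
★ p861439 `finsum_stratum_shell_labelledOdd_div_relIndex_swap01`; `ω(−e_C)·ω(−1) = ω(e_C)` (★ `normSign_mul_of_fixed`). [cite: Kottwitz1986BaseChangeUnits, §1 pp. 240–241]
[cite: Rogawski1990, §4.9 Prop. 4.9.1 (a)(b) p. 55] [cite: LanglandsShelstad1987, §3] -/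
theorem finsum_stratum_G3_shell_labelledOdd_div_relIndex_beyond_one (hD : IsRamifiedQuadraticDatum σ ϖ d t) (h2 : Valued.v (2 : K) < 1) (h2d : 2 ≤ d)
    (hE : IsElementDatum σ ϖ N₀ α β n₁ n₂ n₃) (hN₀ : d ≤ N₀) (hmc : mcOfRecord d ≤ N₀)
    (T : GL (Fin 3) K) (hT : (T : Matrix (Fin 3) (Fin 3) K) = Matrix.diagonal ![α, β, 1]) (ρ s : ℕ) (hρ : 1 ≤ ρ)
    (hlt₂ : n₂ < 2 * ρ + mstarOfRecord d) (hP : 2 * ρ + s + d % 2 = n₃) (h2s : 2 ∣ s) (hcap : 2 * ρ + 2 + d % 2 ≤ min n₁ n₂)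
    {eC : K} (hσeC : σ eC = eC) (heC1 : Valued.v eC = 1)
    (heC : Valued.v ((ϖ ^ mstarOfRecord d)⁻¹ * ((β - α) * ((ϖ * σ ϖ) ^ ((n₃ - d % 2) / 2))⁻¹ - eC * ((ϖ - σ ϖ) * ((ϖ * σ ϖ) ^ ((d - d % 2) / 2))⁻¹))) ≤ 1) :
    ∑ᶠ M ∈ {M : Submodule 𝒪[K] (Fin 3 → K) | M ∈ stratum σ ϖ T ![2 * ρ + s, 2 * ρ + s, 2 * ρ] ∧
        (LatticeInLevel ϖ (d % 2) (Matrix.diagonal ![α - 1, β - 1, 0]) M ∧ ¬ LatticeInLevel ϖ (d % 2 + 1) (Matrix.diagonal ![α - 1, β - 1, 0]) M ∧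
          LatticeInLevel ϖ (mcOfRecord d) (Matrix.diagonal ![(α - 1) * (α - 1), (β - 1) * (β - 1), 0]) M)},
      (labelledOddCount σ ϖ 0 1 (valueClassLabel σ ϖ (α - 1) (β - 1) (mstarOfRecord d) d) M : ℚ) /
        ((((unitStabilizer M).map (unitNormMap σ 3)).relIndex (fixedUnitTorus σ 3) : ℕ) : ℚ) =
      (normSign σ eC : ℚ) / 2 * (Fintype.card 𝓀[K] : ℚ) ^ (2 * ρ + s / 2 - 1) *
        ((if 2 * d + d % 2 + 2 * ρ ≤ n₂ then (Fintype.card 𝓀[K] : ℚ) - 1 else 0) - (if n₂ + 2 = 2 * d + d % 2 + 2 * ρ then 1 else 0)) := by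
  have hD' := hD
  obtain ⟨hσ, -, -, -, -, -, -⟩ := hD'
  haveI : Finite 𝓀[K] := Finite.of_fintype _
  have heC0 : eC ≠ 0 := fun h => by rw [h, map_zero] at heC1; exact zero_ne_one heC1
  -- `−e_C` is a token of `α − β`
  have hσeC' : σ (-eC) = -eC := by rw [map_neg, hσeC]
  have heC1' : Valued.v (-eC) = 1 := by rw [Valuation.map_neg, heC1]
  have heC' : Valued.v ((ϖ ^ mstarOfRecord d)⁻¹ * ((α - β) * ((ϖ * σ ϖ) ^ ((n₃ - d % 2) / 2))⁻¹ -
      (-eC) * ((ϖ - σ ϖ) * ((ϖ * σ ϖ) ^ ((d - d % 2) / 2))⁻¹))) ≤ 1 := by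
    have e : (ϖ ^ mstarOfRecord d)⁻¹ * ((α - β) * ((ϖ * σ ϖ) ^ ((n₃ - d % 2) / 2))⁻¹ - (-eC) * ((ϖ - σ ϖ) * ((ϖ * σ ϖ) ^ ((d - d % 2) / 2))⁻¹)) =
        -((ϖ ^ mstarOfRecord d)⁻¹ * ((β - α) * ((ϖ * σ ϖ) ^ ((n₃ - d % 2) / 2))⁻¹ - eC * ((ϖ - σ ϖ) * ((ϖ * σ ϖ) ^ ((d - d % 2) / 2))⁻¹))) := by ring
    rw [e, Valuation.map_neg]
    exact heC
  -- the swapped torus element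
  obtain ⟨P, hP'⟩ := exists_gl_coe_eq_permMatrix (K := K) (Equiv.swap (0 : Fin 3) 1)
  have hd : (![α, β, 1] : Fin 3 → K) ∘ ⇑(Equiv.swap (0 : Fin 3) 1).symm = ![β, α, 1] := by
    ext j; fin_cases j <;> rfl
  have hT' : ((P⁻¹ * T * P : GL (Fin 3) K) : Matrix (Fin 3) (Fin 3) K) = Matrix.diagonal ![β, α, 1] := by rw [coe_conj_eq_diagonal P hP' T hT, hd]
  rw [finsum_stratum_shell_labelledOdd_div_relIndex_swap01 σ ϖ (α - 1) (β - 1) (mstarOfRecord d) d 0 T (P⁻¹ * T * P) hT hT'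
    (2 * ρ + s) (2 * ρ + s) (2 * ρ) (d % 2) (d % 2 + 1) (mcOfRecord d) (α - 1) (β - 1) 0 ((α - 1) * (α - 1)) ((β - 1) * (β - 1)) 0 1]
  have h10 : Equiv.swap (0 : Fin 3) 1 1 = 0 := Equiv.swap_apply_right _ _
  rw [h10, finsum_stratum_G3_shell_labelledOdd_div_relIndex_beyond_zero hD h2 h2d (isElementDatum_swap hE) hN₀ hmc (P⁻¹ * T * P) hT' ρ s hρ hlt₂ hP h2s
    (by rwa [min_comm]) hσeC' heC1' heC']
  have hneg : normSign σ (-eC) = normSign σ (-1 : K) * normSign σ eC := by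
    rw [show (-eC : K) = -1 * eC by ring]
    exact normSign_mul_of_fixed hD (by rw [map_neg, map_one]) hσeC (by norm_num) heC0
  have hωm : (normSign σ (-1 : K) : ℚ) * (normSign σ (-1 : K) : ℚ) = 1 := by
    unfold normSign; split_ifs <;> norm_num
  rw [hneg]
  push_cast
  linear_combination ((normSign σ eC : ℚ) / 2 * (Fintype.card 𝓀[K] : ℚ) ^ (2 * ρ + s / 2 - 1) *
    ((if 2 * d + d % 2 + 2 * ρ ≤ n₂ then (Fintype.card 𝓀[K] : ℚ) - 1 else 0) - (if n₂ + 2 = 2 * d + d % 2 + 2 * ρ then 1 else 0))) * hωm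

/-! ## §2  R5b: all three slots on `n₁, n₂ < 2ρ + m*` -/

/-- **R5b — THE G₃ CAPPED TUBE WITH BOTH OTHER DEPTHS BEYOND THE CELL** (`n₁, n₂ < 2ρ + m*`), all three slots, in the bracket currency of ★ p861354 `hbeyond` VERBATIM:
`Σᶠ_{M ∈ stratum G₃, shell} m^Λ_i(M) ∕ [𝒰 : N(S̃(M))] = ω(e_C)∕2 · q^{2ρ+s∕2−1} · (ω(−1)·B(n₁), B(n₂), 0)_i` — slot 0 = ★ p861925 THEOREM A (LH7-p06 (g0)), slot 1 = §1, slot 2 = ★ p861837.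
[cite: Kottwitz1986BaseChangeUnits, §1 pp. 240–241] [cite: Rogawski1990, §4.9 Prop. 4.9.1 (a)(b) p. 55, §4.10 p. 58] [cite: LanglandsShelstad1987, §3] -/
theorem finsum_stratum_G3_shell_labelledOdd_div_relIndex_beyond₂ (hD : IsRamifiedQuadraticDatum σ ϖ d t) (h2 : Valued.v (2 : K) < 1) (h2d : 2 ≤ d)
    (hE : IsElementDatum σ ϖ N₀ α β n₁ n₂ n₃) (hN₀ : d ≤ N₀) (hmc : mcOfRecord d ≤ N₀)
    (T : GL (Fin 3) K) (hT : (T : Matrix (Fin 3) (Fin 3) K) = Matrix.diagonal ![α, β, 1]) (ρ s : ℕ) (hρ : 1 ≤ ρ)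
    (hlt₁ : n₁ < 2 * ρ + mstarOfRecord d) (hlt₂ : n₂ < 2 * ρ + mstarOfRecord d)
    (hP : 2 * ρ + s + d % 2 = n₃) (h2s : 2 ∣ s) (hcap : 2 * ρ + 2 + d % 2 ≤ min n₁ n₂)
    {eC : K} (hσeC : σ eC = eC) (heC1 : Valued.v eC = 1)
    (heC : Valued.v ((ϖ ^ mstarOfRecord d)⁻¹ * ((β - α) * ((ϖ * σ ϖ) ^ ((n₃ - d % 2) / 2))⁻¹ - eC * ((ϖ - σ ϖ) * ((ϖ * σ ϖ) ^ ((d - d % 2) / 2))⁻¹))) ≤ 1)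
    (i : Fin 3) :
    ∑ᶠ M ∈ {M : Submodule 𝒪[K] (Fin 3 → K) | M ∈ stratum σ ϖ T ![2 * ρ + s, 2 * ρ + s, 2 * ρ] ∧
        (LatticeInLevel ϖ (d % 2) (Matrix.diagonal ![α - 1, β - 1, 0]) M ∧ ¬ LatticeInLevel ϖ (d % 2 + 1) (Matrix.diagonal ![α - 1, β - 1, 0]) M ∧
          LatticeInLevel ϖ (mcOfRecord d) (Matrix.diagonal ![(α - 1) * (α - 1), (β - 1) * (β - 1), 0]) M)},
      (labelledOddCount σ ϖ 0 i (valueClassLabel σ ϖ (α - 1) (β - 1) (mstarOfRecord d) d) M : ℚ) /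
        ((((unitStabilizer M).map (unitNormMap σ 3)).relIndex (fixedUnitTorus σ 3) : ℕ) : ℚ) =
      (normSign σ eC : ℚ) / 2 * (Fintype.card 𝓀[K] : ℚ) ^ (2 * ρ + s / 2 - 1) *
        (![(normSign σ (-1 : K) : ℚ) * ((if 2 * d + d % 2 + 2 * ρ ≤ n₁ then (Fintype.card 𝓀[K] : ℚ) - 1 else 0) - (if n₁ + 2 = 2 * d + d % 2 + 2 * ρ then 1 else 0)),
            ((if 2 * d + d % 2 + 2 * ρ ≤ n₂ then (Fintype.card 𝓀[K] : ℚ) - 1 else 0) - (if n₂ + 2 = 2 * d + d % 2 + 2 * ρ then 1 else 0)),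
            (0 : ℚ)] : Fin 3 → ℚ) i := by
  fin_cases i
  · simp only [Fin.zero_eta, Matrix.cons_val_zero]
    exact finsum_stratum_G3_shell_labelledOdd_div_relIndex_beyond_zero hD h2 h2d hE hN₀ hmc T hT ρ s hρ hlt₁ hP h2s hcap hσeC heC1 heC
  · simp only [Fin.mk_one, Matrix.cons_val_one, Matrix.cons_val_zero]
    exact finsum_stratum_G3_shell_labelledOdd_div_relIndex_beyond_one hD h2 h2d hE hN₀ hmc T hT ρ s hρ hlt₂ hP h2s hcap hσeC heC1 heC
  · simp only [Fin.reduceFinMk, Matrix.cons_val_two, Matrix.tail_cons, Matrix.head_cons, mul_zero]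
    exact finsum_stratum_G3_shell_labelledOdd_div_relIndex_slot_two_eq_zero hD h2 h2d hE hN₀ hmc T hT ρ s hρ hP h2s hcap hσeC heC1 heC

/-! ## §3  The whole `hbeyond` binder: `n₁ < 2ρ + m*`, any `n₂` -/

/-- **THE `hbeyond` HEAD OF ★ p861354 `hG3t_of_cell_and_beyond` — ALL CAPPED TUBE CLASSES OF TOWER 3 WITH `n₁ < 2ρ + m*`** (read `2ρ + s + ℓ₀ = n₃`, `2 ∣ s`, guard
`2ρ + 2 + ℓ₀ ≤ min n₁ n₂`; token `e_C` of `β − α`; `2 ≤ d ≤ N₀`, `mcOfRecord d ≤ N₀`, `|2| < 1`), in the bracket currency VERBATIM: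
`Σᶠ_{M ∈ stratum G₃, shell} m^Λ_i(M) ∕ [𝒰 : N(S̃(M))] = ω(e_C)∕2 · q^{2ρ+s∕2−1} · (ω(−1)·B(n₁), B(n₂), 0)_i` — `Nat.lt_or_ge n₂ (2ρ + m*)`: §2 (R5b) or ★ p861504 R5a `…_beyond_of_cell₂`.
With the cell column ★ `…_eq_ofRecord` (LH4-p11 (g9)) the G₃ row `hG3t` ∕ `hP2G3` of the (β) table is the assembler's composition. [cite: Kottwitz1986BaseChangeUnits, §1 pp. 240–241]
[cite: Rogawski1990, §4.9 Prop. 4.9.1 (a)(b) p. 55, §4.10 p. 58] [cite: LanglandsShelstad1987, §3] -/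
theorem finsum_stratum_G3_shell_labelledOdd_div_relIndex_beyond (hD : IsRamifiedQuadraticDatum σ ϖ d t) (h2 : Valued.v (2 : K) < 1) (h2d : 2 ≤ d)
    (hE : IsElementDatum σ ϖ N₀ α β n₁ n₂ n₃) (hN₀ : d ≤ N₀) (hmc : mcOfRecord d ≤ N₀)
    (T : GL (Fin 3) K) (hT : (T : Matrix (Fin 3) (Fin 3) K) = Matrix.diagonal ![α, β, 1]) (ρ s : ℕ) (hρ : 1 ≤ ρ)
    (hlt : n₁ < 2 * ρ + mstarOfRecord d) (hP : 2 * ρ + s + d % 2 = n₃) (h2s : 2 ∣ s) (hcap : 2 * ρ + 2 + d % 2 ≤ min n₁ n₂)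
    {eC : K} (hσeC : σ eC = eC) (heC1 : Valued.v eC = 1)
    (heC : Valued.v ((ϖ ^ mstarOfRecord d)⁻¹ * ((β - α) * ((ϖ * σ ϖ) ^ ((n₃ - d % 2) / 2))⁻¹ - eC * ((ϖ - σ ϖ) * ((ϖ * σ ϖ) ^ ((d - d % 2) / 2))⁻¹))) ≤ 1)
    (i : Fin 3) :
    ∑ᶠ M ∈ {M : Submodule 𝒪[K] (Fin 3 → K) | M ∈ stratum σ ϖ T ![2 * ρ + s, 2 * ρ + s, 2 * ρ] ∧
        (LatticeInLevel ϖ (d % 2) (Matrix.diagonal ![α - 1, β - 1, 0]) M ∧ ¬ LatticeInLevel ϖ (d % 2 + 1) (Matrix.diagonal ![α - 1, β - 1, 0]) M ∧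
          LatticeInLevel ϖ (mcOfRecord d) (Matrix.diagonal ![(α - 1) * (α - 1), (β - 1) * (β - 1), 0]) M)},
      (labelledOddCount σ ϖ 0 i (valueClassLabel σ ϖ (α - 1) (β - 1) (mstarOfRecord d) d) M : ℚ) /
        ((((unitStabilizer M).map (unitNormMap σ 3)).relIndex (fixedUnitTorus σ 3) : ℕ) : ℚ) =
      (normSign σ eC : ℚ) / 2 * (Fintype.card 𝓀[K] : ℚ) ^ (2 * ρ + s / 2 - 1) *
        (![(normSign σ (-1 : K) : ℚ) * ((if 2 * d + d % 2 + 2 * ρ ≤ n₁ then (Fintype.card 𝓀[K] : ℚ) - 1 else 0) - (if n₁ + 2 = 2 * d + d % 2 + 2 * ρ then 1 else 0)),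
            ((if 2 * d + d % 2 + 2 * ρ ≤ n₂ then (Fintype.card 𝓀[K] : ℚ) - 1 else 0) - (if n₂ + 2 = 2 * d + d % 2 + 2 * ρ then 1 else 0)),
            (0 : ℚ)] : Fin 3 → ℚ) i := by
  rcases Nat.lt_or_ge n₂ (2 * ρ + mstarOfRecord d) with hlt₂ | hge₂
  · exact finsum_stratum_G3_shell_labelledOdd_div_relIndex_beyond₂ hD h2 h2d hE hN₀ hmc T hT ρ s hρ hlt hlt₂ hP h2s hcap hσeC heC1 heC i
  · exact finsum_stratum_G3_shell_labelledOdd_div_relIndex_beyond_of_cell₂ hD h2 h2d hE hN₀ hmc T hT ρ s hρ hlt hge₂ hP h2s hcap hσeC heC1 heC i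

end Summit.HodgeConjecture.HodgeConjecture.Cruxes.H413.F0P3cDyRamLabelledOddBoundaryG3Beyond

end
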